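import Literature.NumberTheory.Sieve.ElliottHalberstamBridgeProofs
import Summits.Parity.GeneralizedHardyLittlewood.Theorems.LiouvilleShiftedTablesEHStubLowConductor
import Summits.Parity.GeneralizedHardyLittlewood.Theorems.LiouvilleShiftedTablesEHStubReplication
import Summits.Parity.GeneralizedHardyLittlewood.Theorems.LiouvilleShiftedTablesEHStubBadModuliSparse
import Summits.Parity.GeneralizedHardyLittlewood.Theorems.LiouvilleShiftedTablesEHStubDescentGraded

/-!
# Level of distribution `x^θ`, `θ < 1 − ε'`, from purity of the single window `x^{1−ε'}`
# (crux `stmt-Parity-11314` `EH`, line `upward-replication-free-factorability`, graded bridge)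

The level-by-level CONDITIONAL content of the line, with every provable input discharged: the
landed stubs `LowConductor.stub_lowConductor` (low conductors are harmless at every level),
`Replication.stub_replication` (the replication inequality for the conductor-excised discrepancy
`Δ♯`) and `BadModuliSparse.stub_badModuliSparse` (bad moduli are harmonically sparse) fed into the
landed graded descent `DescentGraded.stub_descentGraded` give:

  purity of the window `(x^{1−ε'}, 2x^{1−ε'}]` ⟹ `EH θ` for every `θ < 1 − ε'`

(`Literature.NumberTheory.Sieve.EH θ`, the Wave0 form: for every real `A`,
`∑_{q ≤ x^θ} max_{a unit} |ψ(x; q, a) − x/φ(q)| = O(x/(log x)^A)`).  Here purity of the window at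
exponent `ε' > 0` (hypothesis `hPurity`, spelled out) says: for every `B > 0` there are
`δ₀ ∈ (0, 1/2)`, `η > 0`, `x₀` such that for `x ≥ x₀` all moduli `m` of the window outside a set `I`
with `#I ≤ x^{1−ε'−η}` satisfy
`max_{a unit} ‖φ(m)⁻¹ ∑_{χ mod m, cond χ > ⌊x^{1/2−δ₀}⌋} χ(a⁻¹) ψ(x, χ)‖ < x/(φ(m)(log x)^B)`.
In particular POWER-sparse purity of `Δ♯` in a window just above `x^{1/2}` (`ε' = 1/2 − δ`) would
give the primes a level of distribution `x^{1/2+δ'}` for every `δ' < δ`, beyond Bombieri–Vinogradov;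
for `ε' > 1/2` the hypothesis is a theorem (Barban–Davenport–Halberstam + Markov) and the conclusion
is Bombieri–Vinogradov.  The hypothesis is open for every `ε' ≤ 1/2` (conjecture-grade: implied by
Montgomery's conjecture, not known to follow from EH).

References: H. Davenport, *Multiplicative Number Theory*, ch. 28; H. Iwaniec, E. Kowalski,
*Analytic Number Theory*, §17.1; line card `Cruxes/EH/Lines/upward-replication-free-factorability.md`.
-/

namespace Summit.Parity.GeneralizedHardyLittlewood.Theorems.EH.OfTopWindowPurity

/-- **Purity of one window gives every level below it.** For `ε' > 0`: power-sparse purity of the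
conductor-excised discrepancy in the window of moduli `(x^{1−ε'}, 2x^{1−ε'}]` implies the
Elliott–Halberstam estimate `EH θ` (Wave0 form, every real `A`) for every `θ < 1 − ε'`.  Composition
of the landed stubs `stub_lowConductor`, `stub_replication`, `stub_badModuliSparse` with the landed
graded descent `stub_descentGraded`; the purity statement is the only hypothesis. [folklore] -/
theorem eh_level_of_purityAt (ε' : ℝ) (hε' : 0 < ε')
    (hPurity : ∀ B : ℝ, 0 < B →
      ∃ δ₀ : ℝ, 0 < δ₀ ∧ δ₀ < 1 / 2 ∧ ∃ η : ℝ, 0 < η ∧ ∃ x₀ : ℝ, ∀ x : ℝ, x₀ ≤ x →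
        ∃ I : Finset ℕ, (I.card : ℝ) ≤ x ^ (1 - ε' - η) ∧
          ∀ m ∈ Finset.Ioc ⌊x ^ (1 - ε')⌋₊ ⌊2 * x ^ (1 - ε')⌋₊, m ∉ I →
            (⨆ a : (ZMod m)ˣ,
                ‖((Nat.totient m : ℂ))⁻¹ *
                    ∑ χ ∈ (Finset.univ : Finset (DirichletCharacter ℂ m)) with
                        ⌊x ^ (1 / 2 - δ₀)⌋₊ < χ.conductor,
                      χ (a : ZMod m)⁻¹ * Literature.NumberTheory.Sieve.chebyshevPsiChar χ x‖) <
              x / ((Nat.totient m : ℝ) * Real.log x ^ B))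
    (θ : ℝ) (hθ : θ < 1 - ε') :
    Literature.NumberTheory.Sieve.EH θ :=
  Summit.Parity.GeneralizedHardyLittlewood.Theorems.EH.DescentGraded.stub_descentGraded
    Summit.Parity.GeneralizedHardyLittlewood.Theorems.EH.LowConductor.stub_lowConductor
    Summit.Parity.GeneralizedHardyLittlewood.Theorems.EH.Replication.stub_replication
    Summit.Parity.GeneralizedHardyLittlewood.Theorems.EH.BadModuliSparse.stub_badModuliSparse
    ε' hε' hPurity θ hθ

end Summit.Parity.GeneralizedHardyLittlewood.Theorems.EH.OfTopWindowPurity
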